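import Summits.BirchSwinnertonDyer.BirchSwinnertonDyer.Theorems.ManinLocalTwoThreeShimuraSectorCocycles
import Summits.BirchSwinnertonDyer.BirchSwinnertonDyer.Theorems.ManinLocalTwoThreeVertexAssembly

/-!
# THEOREM 54 (imc g42) — part 2/4 (§4, §6.1–6.2): SECTOR MULTIPLICITY ONE ⟹ THE SHIMURA CHARACTER FACTORS THROUGH THE PERIOD
# HOMOMORPHISM; `U_p = p` on diamond cocycles and the `d`-entry of the Atkin–Lehner conjugate
# (cell bsd-f2-manin, LENS imc, route `ManinLocalTwoThree`, crux C3 `ManinPrimeToThreeAtNine` stmt-BirchSwinnertonDyer-22968 / C2 `ManinOddAtFour` stmt-22967)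

THEOREM 54 (`exists_functional_eq_diamond_of_sectorMultiplicityOne`).  `f` the newform of `W` (level `N`), `ℓ` prime,
`ψ : Λ₀(f) → 𝔽_ℓ` additive, `ψ ≠ 0`, star-even (`ψ(x̄) = ψ(x)`); Eisenstein congruence `a_p(W) ≡ 1 + p` (`p ∈ S`, `p ∤ N`),
`a_p(W) ≡ p` (`p ∈ S`, `p ∣ N`) mod `ℓ`; `w_Q f = ε_Q f` (`Q ∈ 𝒬`); `E_χ` in the sector of signs `ε`; MULTIPLICITY ONE in that
sector.  THEN the Shimura character factors through Manin's period homomorphism: **there is an additive `φ : Λ₀(f) → 𝔽_ℓ` with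
`φ({∞, γ∞}_f) = χ(d_γ)` for every `γ ∈ Γ₀(N)`.**  COROLLARY (`exists_functional_ne_zero_vanishing_on_periodLatticeGamma1`):
if moreover `χ(1) = 0` and `χ(a) ≠ 0` for some unit `a`, then `φ ≠ 0` and `φ(Λ₁(f)) = 0` — `Λ₀(f)/Λ₁(f) ↠ ℤ/ℓ`, in particular
`Λ₁(f) ≠ Λ₀(f)` («`ℓ ∣ s_A`», E-imc-53R(⟸)).  PROOF: `u_ψ` lies in the sector (parabolic: Knapp Prop. 11.1
`cuspSymbol_eq_zero_of_isParabolic`; Hecke: `heckeU_functionalCocycle` + the congruence; `W_Q`: Manin's transport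
`MultAL.cuspSymbol_eq_mul_of_conj_alW`; star: `{∞, JγJ∞}_f = conj{∞, γ∞}_f` for real `f`), `u_ψ ≠ 0` (`Λ₀(f)` is the range of
the period homomorphism), so multiplicity one gives `u_ψ = c·E_χ`, `c ≠ 0`, and `φ = c⁻¹ψ`.

HONEST FRAMING.  Kernel theorems are unconditional MODULO their typed hypotheses (`SectorMultiplicityOne …` = CONJECTURE M1 per
tuple, open; the `@[conjecture]` rank laws are typed census candidates, NOT theorems).  Nothing about C2/C3, Manin's conjecture or
BSD is proved here.  Source: imc g42/g43 planner sketch `HOME/imc/g43/Sketch59full.lean` 8602093605f9eb5d (MEMO-imc §53.10, §54, §55),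
landed verbatim by LEAD p1 g26 in four parts: 1 `…ShimuraSectorCocycles` (§1–§3), 2 `…ShimuraSectorCapture` (§4 THEOREM 54, §6.1–6.2),
3 `…ShimuraSectorTame` (§6.3–§7), 4 `…ShimuraSectorRankLaw` (§8–§9).
[cite: Mazur1977, II.9 and II.16 (Eisenstein ideal, multiplicity one at prime level)] [cite: Manin1972, Prop. 1.4 / Thm. 1.6]
[cite: Knapp1993, Prop. 11.1, Lemma 9.24] [cite: Shimura1971, §8.1 (8.1.4), §8.3 (8.3.2)] [cite: Stevens1989, §2]
-/

set_option autoImplicit false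
set_option linter.dupNamespace false

noncomputable section

open scoped Classical ComplexConjugate MatrixGroups ModularForm BigOperators

open CongruenceSubgroup Matrix.SpecialLinearGroup Complex
open Literature.NumberTheory.EllipticCurves Literature.NumberTheory.EllipticCurves.ModularForms
open Literature.NumberTheory.EllipticCurves.ModularForms.HidaCohomology
open Summit.BirchSwinnertonDyer.Rank1Residual.ManinAdditive (diamondFun diamondFun_apply)

namespace Summit.BirchSwinnertonDyer.BirchSwinnertonDyer.Theorems.ManinLocalTwoThree.ShimuraSector

section Main

variable {N : ℕ} [NeZero N] {f : CuspForm (Gamma0 N) 2} {ℓ : ℕ} [Fact ℓ.Prime]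

/-- **The functional cocycle of an Eisenstein-semilinear, star-even `ψ` lies in the Eisenstein sector of `f`'s signs**
(the four equivariances of §3 bundled; kernel-closed witness for `IsShimuraEisenstein`). [cite: Mazur1977, II.9] -/
theorem uψ_isShimuraEisenstein (hf : IsNewform0 f) (S 𝒬 : Finset ℕ) (ε : ℕ → ℤ)
    (hAL : ∀ Q ∈ 𝒬, ∀ [NeZero Q], Q ∣ N → Nat.Coprime Q (N / Q) → atkinLehnerInvolution N 2 Q f = ((ε Q : ℤ) : ℂ) • f)
    (ψ : ↥(periodLattice f) →+ ZMod ℓ)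
    (hψT : ∀ p ∈ S, p.Prime → ∀ (x : ↥(periodLattice f)) (hx : cuspCoeff f p * (x : ℂ) ∈ periodLattice f),
      ψ ⟨cuspCoeff f p * (x : ℂ), hx⟩ = (if p ∣ N then (p : ZMod ℓ) else (p : ZMod ℓ) + 1) * ψ x)
    (hψstar : ∀ (x : ↥(periodLattice f)) (hx : conj (x : ℂ) ∈ periodLattice f), ψ ⟨conj (x : ℂ), hx⟩ = ψ x) :
    IsShimuraEisenstein N (ZMod ℓ) S 𝒬 (fun Q => ((ε Q : ℤ) : ZMod ℓ)) (uψ f ψ) := by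
  refine ⟨uψ_mem_parSp ψ, fun p _ hp hpS hpN => ?_, fun p _ hp hpS hpN => ?_, fun Q _ hQN hc hQ => ?_,
    starOp_uψ ψ hf.cuspCoeff_im_eq_zero hψstar⟩
  · rw [heckeU_uψ ψ hf hp (hψT p hpS hp)]; simp only [if_neg hpN]
  · rw [heckeU_uψ ψ hf hp (hψT p hpS hp)]; simp only [if_pos hpN]
  · exact alOp_uψ ψ Q hQN hc (hAL Q hQ hQN hc)

/-- **THEOREM 54 (= 53.B), any degree `d`.**  `f` a newform of level `N`; `ψ : Λ₀(f) → 𝔽_ℓ` additive, non-zero,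
star-even and EISENSTEIN-SEMILINEAR on `S` (`ψ(a_p x) = (1+p)ψ(x)` for `p ∤ N`, `= p ψ(x)` for `p ∣ N` — i.e. `ψ` factors
through `Λ₀(f)/𝔪Λ₀(f)`, `𝔪 = (λ, T_p − 1 − p, U_q − q)` the Eisenstein maximal ideal of the Hecke order); `w_Q f = ε_Q f` on
`𝒬`; `E_χ` in the sector of signs `ε`; MULTIPLICITY ONE in that sector.  THEN `γ ↦ χ(d_γ)` FACTORS THROUGH MANIN'S PERIOD
HOMOMORPHISM `γ ↦ {∞, γ∞}_f`: some additive `φ : Λ₀(f) → 𝔽_ℓ` has `φ({∞, γ∞}_f) = χ(d_γ)` for all `γ ∈ Γ₀(N)`.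
[cite: Mazur1977, II.16 (multiplicity one for the Eisenstein ideal)] [cite: Manin1972, Thm. 1.9] -/
theorem exists_functional_eq_diamond_of_sectorMultiplicityOne (hf : IsNewform0 f)
    (S 𝒬 : Finset ℕ) (ε : ℕ → ℤ) (χ : ZMod N → ZMod ℓ)
    (hAL : ∀ Q ∈ 𝒬, ∀ [NeZero Q], Q ∣ N → Nat.Coprime Q (N / Q) → atkinLehnerInvolution N 2 Q f = ((ε Q : ℤ) : ℂ) • f)
    (ψ : ↥(periodLattice f) →+ ZMod ℓ) (hψ0 : ψ ≠ 0)
    (hψT : ∀ p ∈ S, p.Prime → ∀ (x : ↥(periodLattice f)) (hx : cuspCoeff f p * (x : ℂ) ∈ periodLattice f),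
      ψ ⟨cuspCoeff f p * (x : ℂ), hx⟩ = (if p ∣ N then (p : ZMod ℓ) else (p : ZMod ℓ) + 1) * ψ x)
    (hψstar : ∀ (x : ↥(periodLattice f)) (hx : conj (x : ℂ) ∈ periodLattice f), ψ ⟨conj (x : ℂ), hx⟩ = ψ x)
    (hE : IsShimuraEisenstein N (ZMod ℓ) S 𝒬 (fun Q => ((ε Q : ℤ) : ZMod ℓ)) (diamondFun N N (ZMod ℓ) χ))
    (hM1 : SectorMultiplicityOne N (ZMod ℓ) S 𝒬 (fun Q => ((ε Q : ℤ) : ZMod ℓ)) χ) :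
    ∃ φ : ↥(periodLattice f) →+ ZMod ℓ,
      ∀ γ : Gamma0 N, φ ⟨cuspSymbol f γ, cuspSymbol_mem_periodLattice f γ⟩ = χ ((((γ : SL(2, ℤ)) 1 1 : ℤ) : ZMod N)) := by
  -- `u_ψ` lies in the sector
  have hu := uψ_isShimuraEisenstein hf S 𝒬 ε hAL ψ hψT hψstar
  -- multiplicity one: `u_ψ = c • E_χ` with `c ≠ 0`
  obtain ⟨c, hc⟩ := hM1 hE (uψ f ψ) hu
  have hc0 : c ≠ 0 := by
    rintro rfl
    rw [zero_smul] at hc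
    exact hψ0 (ψ_eq_zero_of_uψ_eq_zero ψ hc)
  refine ⟨AddMonoidHom.mk' (fun x => c⁻¹ * ψ x) (fun x y => by rw [map_add, mul_add]), fun γ => ?_⟩
  have hγ := congrFun (congrFun hc γ) 0
  simp only [uψ_apply, Pi.smul_apply, diamondFun_apply, smul_eq_mul] at hγ
  rw [AddMonoidHom.mk'_apply, hγ, ← mul_assoc, inv_mul_cancel₀ hc0, one_mul]

/-- **COROLLARY 54.1 (capture ⟹ `ℓ ∣ [Λ₀(f) : Λ₁(f)]`).**  Under the hypotheses of THEOREM 54, if `χ(1) = 0` and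
`χ(a) ≠ 0` for some unit `a` of `ℤ/N` (e.g. `χ` a non-trivial additive character of `(ℤ/N)ˣ`), there is a NON-ZERO
additive `φ : Λ₀(f) → 𝔽_ℓ` vanishing on `Λ₁(f)`; hence `Λ₁(f) ≠ Λ₀(f)` and `ℓ` divides the Shimura index
`[Λ₀(f) : Λ₁(f)]` («`ℓ ∣ s_A(f)`», E-imc-53R(⟸) at every level with multiplicity one). [cite: Stevens1989, §2]
[cite: Mazur1977, II.16] -/
theorem dvd_shimuraIndex_of_sectorMultiplicityOne (hf : IsNewform0 f)
    (S 𝒬 : Finset ℕ) (ε : ℕ → ℤ) (χ : ZMod N → ZMod ℓ)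
    (hAL : ∀ Q ∈ 𝒬, ∀ [NeZero Q], Q ∣ N → Nat.Coprime Q (N / Q) → atkinLehnerInvolution N 2 Q f = ((ε Q : ℤ) : ℂ) • f)
    (ψ : ↥(periodLattice f) →+ ZMod ℓ) (hψ0 : ψ ≠ 0)
    (hψT : ∀ p ∈ S, p.Prime → ∀ (x : ↥(periodLattice f)) (hx : cuspCoeff f p * (x : ℂ) ∈ periodLattice f),
      ψ ⟨cuspCoeff f p * (x : ℂ), hx⟩ = (if p ∣ N then (p : ZMod ℓ) else (p : ZMod ℓ) + 1) * ψ x)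
    (hψstar : ∀ (x : ↥(periodLattice f)) (hx : conj (x : ℂ) ∈ periodLattice f), ψ ⟨conj (x : ℂ), hx⟩ = ψ x)
    (hE : IsShimuraEisenstein N (ZMod ℓ) S 𝒬 (fun Q => ((ε Q : ℤ) : ZMod ℓ)) (diamondFun N N (ZMod ℓ) χ))
    (hM1 : SectorMultiplicityOne N (ZMod ℓ) S 𝒬 (fun Q => ((ε Q : ℤ) : ZMod ℓ)) χ)
    (hχ1 : χ 1 = 0) (hχ : ∃ a : ZMod N, IsUnit a ∧ χ a ≠ 0) :
    ∃ φ : ↥(periodLattice f) →+ ZMod ℓ, φ ≠ 0 ∧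
      (∀ (x : ℂ) (hx : x ∈ periodLatticeGamma1 f), φ ⟨x, periodLatticeGamma1_le_periodLattice f hx⟩ = 0) ∧
      periodLatticeGamma1 f ≠ periodLattice f ∧ ℓ ∣ (periodLatticeGamma1 f).relIndex (periodLattice f) := by
  obtain ⟨φ, hφ⟩ := exists_functional_eq_diamond_of_sectorMultiplicityOne hf S 𝒬 ε χ hAL ψ hψ0 hψT hψstar hE hM1
  -- `φ ≠ 0`: some `γ` has `χ(d_γ) ≠ 0`
  have hφ0 : φ ≠ 0 := by
    obtain ⟨a, ha, hχa⟩ := hχ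
    obtain ⟨γ, hγ⟩ := exists_gamma0_apply_one_one_eq_of_isUnit (N := N) ha
    intro h0
    apply hχa
    rw [← hγ, ← hφ γ, h0, AddMonoidHom.zero_apply]
  -- `φ` kills `Λ₁(f)`: the generators `{∞, γ∞}_f`, `γ ∈ Γ₁(N)`, have `d_γ ≡ 1`
  have hker : periodLatticeGamma1 f ≤ (AddMonoidHom.ker φ).map (periodLattice f).subtype := by
    rw [periodLatticeGamma1, AddSubgroup.closure_le]
    rintro _ ⟨γ, rfl⟩
    refine AddSubgroup.mem_map.mpr ⟨⟨_, cuspSymbol_mem_periodLattice f _⟩, ?_, rfl⟩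
    rw [AddMonoidHom.mem_ker, hφ]
    have h11 : ((((γ : SL(2, ℤ)) : SL(2, ℤ)) 1 1 : ℤ) : ZMod N) = 1 := ((Gamma1_mem N _).mp γ.2).2.1
    simp only [h11, hχ1]
  have hvan : ∀ (x : ℂ) (hx : x ∈ periodLatticeGamma1 f), φ ⟨x, periodLatticeGamma1_le_periodLattice f hx⟩ = 0 := by
    intro x hx
    obtain ⟨y, hy, hyx⟩ := hker hx
    have : (⟨x, periodLatticeGamma1_le_periodLattice f hx⟩ : ↥(periodLattice f)) = y := Subtype.ext hyx.symm
    rw [this]; exact hy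
  refine ⟨φ, hφ0, hvan, fun heq => hφ0 ?_, dvd_relIndex_of_functional φ hφ0 hvan⟩
  ext ⟨x, hx⟩
  have hx1 : x ∈ periodLatticeGamma1 f := by rw [heq]; exact hx
  rw [AddMonoidHom.zero_apply]
  exact hvan x hx1

/-- **`d = 1` (elliptic curves).**  For the newform of `W` the semilinearity is automatic (`a_p ∈ ℤ`) and reads as the
Eisenstein CONGRUENCE `a_p(W) ≡ 1 + p` (`p ∤ N`), `a_p(W) ≡ p` (`p ∣ N`) mod `ℓ` on `S`. [cite: Mazur1977, II.16] -/
theorem dvd_shimuraIndex_of_sectorMultiplicityOne_of_isNewformOf {W : WeierstrassCurve ℚ} (hf : IsNewformOf W f)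
    (S 𝒬 : Finset ℕ) (ε : ℕ → ℤ) (χ : ZMod N → ZMod ℓ)
    (hcong : ∀ p ∈ S, p.Prime → ((W.LFunction p : ℤ) : ZMod ℓ) = if p ∣ N then (p : ZMod ℓ) else (p : ZMod ℓ) + 1)
    (hAL : ∀ Q ∈ 𝒬, ∀ [NeZero Q], Q ∣ N → Nat.Coprime Q (N / Q) → atkinLehnerInvolution N 2 Q f = ((ε Q : ℤ) : ℂ) • f)
    (ψ : ↥(periodLattice f) →+ ZMod ℓ) (hψ0 : ψ ≠ 0)
    (hψstar : ∀ (x : ↥(periodLattice f)) (hx : conj (x : ℂ) ∈ periodLattice f), ψ ⟨conj (x : ℂ), hx⟩ = ψ x)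
    (hE : IsShimuraEisenstein N (ZMod ℓ) S 𝒬 (fun Q => ((ε Q : ℤ) : ZMod ℓ)) (diamondFun N N (ZMod ℓ) χ))
    (hM1 : SectorMultiplicityOne N (ZMod ℓ) S 𝒬 (fun Q => ((ε Q : ℤ) : ZMod ℓ)) χ)
    (hχ1 : χ 1 = 0) (hχ : ∃ a : ZMod N, IsUnit a ∧ χ a ≠ 0) :
    ∃ φ : ↥(periodLattice f) →+ ZMod ℓ, φ ≠ 0 ∧
      (∀ (x : ℂ) (hx : x ∈ periodLatticeGamma1 f), φ ⟨x, periodLatticeGamma1_le_periodLattice f hx⟩ = 0) ∧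
      periodLatticeGamma1 f ≠ periodLattice f ∧ ℓ ∣ (periodLatticeGamma1 f).relIndex (periodLattice f) :=
  dvd_shimuraIndex_of_sectorMultiplicityOne hf.1 S 𝒬 ε χ hAL ψ hψ0
    (fun p hpS hp x hx => by rw [semilinear_of_isNewformOf ψ hf p x hx, hcong p hpS hp]) hψstar hE hM1 hχ1 hχ

end Main

/-! ## §6 (T-imc-55, G2) THE SHIMURA COCYCLE `E_χ` LIES IN ITS OWN SECTOR

For a prime `q₀ ∣ N` and `χ₀ : ℤ/q₀ → 𝔽` additive on units with `χ₀(−1) = 0` (automatic in odd characteristic), the diamond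
cocycle `E_χ₀(γ) = χ₀(d_γ mod q₀)` on `Γ₀(N)` satisfies: `E_χ₀ ∈ parSp` (zero on every parabolic element), `T_p E_χ₀ = (p+1)E_χ₀`
(`p ∤ N`, tree `heckeU_diamondFun_eq_smul`), `U_p E_χ₀ = p E_χ₀` (`p ∣ N`, NEW: all `p` Hecke representatives are upper
triangular and `d' ≡ d (mod N)`), `W_Q E_χ₀ = −E_χ₀` if `q₀ ∣ Q` and `= +E_χ₀` if `q₀ ∣ N/Q` (NEW: the `d`-entry of the
Atkin–Lehner conjugate is `≡ a (mod Q)`, `≡ d (mod N/Q)`), and `E_χ₀⋆ = E_χ₀`.  Hence the antecedent `hE` of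
`SectorMultiplicityOne` / THEOREM 54 is a THEOREM for tame characters, with the sign vector `ε_Q = −1 ⟺ q₀ ∣ Q`
(= TABLE-53B's observed signs: `W_{q₀} = −1`, `W_{ℓ²} = +1`). -/

section DiamondSector

open Summit.BirchSwinnertonDyer.Rank1Residual.ManinAdditive

variable {N : ℕ}

/-! ### 6.1 `U_p = p` on diamond cocycles for `p ∣ N` -/

/-- For `p ∣ N` every Hecke index is finite (`β_∞ = diag(p,1)` is not a representative). [cite: DiamondShurman2005, Prop. 5.2.1] -/
theorem heckeIdx_eq_some {p : ℕ} (hpN : p ∣ N) (i : HeckeIdx N p) : ∃ j : ZMod p, i.1 = some j := by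
  rcases h : i.1 with _ | j
  · exact absurd hpN (i.2 h)
  · exact ⟨j, rfl⟩

/-- For `p ∣ N` there are exactly `p` Hecke representatives. [cite: DiamondShurman2005, Prop. 5.2.1] -/
theorem card_heckeIdx_of_dvd {p : ℕ} [NeZero p] (hpN : p ∣ N) : Fintype.card (HeckeIdx N p) = p := by
  classical
  have e : HeckeIdx N p ≃ ZMod p :=
    (Equiv.subtypeEquivRight (fun i => by
        rw [← Option.ne_none_iff_isSome]
        exact ⟨fun h hn => h hn hpN, fun h hn => absurd hn h⟩)).trans
      (Equiv.optionIsSomeEquiv (ZMod p))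
  rw [Fintype.card_congr e, ZMod.card]

/-- For `p ∣ N` the permuted element `γ'ᵢ` (`γ'ᵢ β_{σ i} = βᵢ γ`) has `d_{γ'ᵢ} = d_γ − c_γ j` for some `j`, hence
`d_{γ'ᵢ} ≡ d_γ (mod N)`. [folklore] -/
theorem heckePermElt_apply_one_one_of_dvd {p : ℕ} (hp : p.Prime) (hpN : p ∣ N) (γ : Gamma0 N) (i : HeckeIdx N p) :
    ∃ j : ℤ, ((heckePermElt hp γ i : SL(2, ℤ)) 1 1 : ℤ) = (γ : SL(2, ℤ)) 1 1 - (γ : SL(2, ℤ)) 1 0 * j := by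
  obtain ⟨j, hj⟩ := heckeIdx_eq_some hpN i
  obtain ⟨j', hj'⟩ := heckeIdx_eq_some hpN (heckePerm hp γ i)
  have hs := heckePermElt_spec hp γ i
  rw [hj, hj'] at hs
  have e10 := congrFun (congrFun hs 1) 0
  have e11 := congrFun (congrFun hs 1) 1
  simp [heckeRep, Matrix.mul_apply, Fin.sum_univ_two] at e10 e11
  refine ⟨(j'.val : ℤ), ?_⟩
  have hp0 : (p : ℤ) ≠ 0 := by exact_mod_cast hp.ne_zero
  have key : (p : ℤ) * (((heckePermElt hp γ i : SL(2, ℤ)) 1 1 : ℤ) - ((γ : SL(2, ℤ)) 1 1 - (γ : SL(2, ℤ)) 1 0 * j'.val)) = 0 := by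
    linear_combination e11 - (j'.val : ℤ) * e10
  rcases mul_eq_zero.mp key with h | h
  · exact absurd h hp0
  · linear_combination h

/-- **`U_p E = p · E` for `p ∣ N`** on every diamond cocycle `E = diamondFun N L' F χ₀` (`L' ∣ N`, ANY `χ₀`): the `p`
representatives `β_j = (1 j; 0 p)` all give `d_{γ'_j} ≡ d_γ (mod N)`. [cite: DiamondShurman2005, Prop. 5.2.1] [cite: Mazur1977, II.16] -/
theorem heckeU_diamondFun_of_dvd {p : ℕ} [NeZero p] (hp : p.Prime) (hpN : p ∣ N) {L' : ℕ} (hL : L' ∣ N)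
    {F : Type*} [CommRing F] (χ₀ : ZMod L' → F) :
    heckeU 0 N F hp (diamondFun N L' F χ₀) = (p : F) • diamondFun N L' F χ₀ := by
  funext γ k
  rw [heckeU_apply]
  simp only [act_zero_eq_id, LinearMap.id_apply, Finset.sum_apply, Pi.smul_apply, diamondFun_apply, smul_eq_mul]
  have hterm : ∀ i : HeckeIdx N p, χ₀ ((((heckePermElt hp γ i : SL(2, ℤ)) 1 1 : ℤ) : ZMod L')) =
      χ₀ ((((γ : SL(2, ℤ)) 1 1 : ℤ) : ZMod L')) := by
    intro i
    obtain ⟨j, hj⟩ := heckePermElt_apply_one_one_of_dvd hp hpN γ i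
    rw [hj]
    push_cast
    rw [gamma0_c_cast_eq_zero hL γ, zero_mul, sub_zero]
  simp_rw [hterm]
  rw [Finset.sum_const, Finset.card_univ, card_heckeIdx_of_dvd hpN, nsmul_eq_mul]

/-! ### 6.2 The `d`-entry of the Atkin–Lehner conjugate -/

/-- **`d`-entry of `w_Q γ w_Q⁻¹`**: if `γ' w_Q = w_Q γ` (`Q ∥ N`) then `d_{γ'} ≡ a_γ (mod Q)` and `d_{γ'} ≡ d_γ (mod N/Q)`
(direct computation with `w_Q = (Qx y; N Q)`, `xQ − y N/Q = 1`). [cite: AtkinLehner1970, Lemma 8] [cite: Knapp1993, Lemma 9.24] -/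
theorem apply_one_one_of_conj_atkinLehnerW [NeZero N] (Q : ℕ) [NeZero Q] (hQN : Q ∣ N) (hc : Nat.Coprime Q (N / Q))
    {γ γ' : Gamma0 N}
    (h : mapGL ℝ (γ' : SL(2, ℤ)) * glCast (atkinLehnerW N Q : GL (Fin 2) ℚ) =
      glCast (atkinLehnerW N Q : GL (Fin 2) ℚ) * mapGL ℝ (γ : SL(2, ℤ))) :
    (Q : ℤ) ∣ ((γ' : SL(2, ℤ)) 1 1 : ℤ) - (γ : SL(2, ℤ)) 0 0 ∧
      ((N / Q : ℕ) : ℤ) ∣ ((γ' : SL(2, ℤ)) 1 1 : ℤ) - (γ : SL(2, ℤ)) 1 1 := by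
  have hint := (MultAL.mapGL_mul_alW_eq_iff hc (γ' : SL(2, ℤ)) (γ : SL(2, ℤ))).mp h
  set M : ℕ := N / Q with hMdef
  obtain ⟨h10, h11⟩ := atkinLehnerSL_apply_one N Q hc
  set x : ℤ := (atkinLehnerSL N Q : SL(2, ℤ)) 0 0 with hx
  set y : ℤ := (atkinLehnerSL N Q : SL(2, ℤ)) 0 1 with hy
  set a : ℤ := (γ : SL(2, ℤ)) 0 0 with ha
  set b : ℤ := (γ : SL(2, ℤ)) 0 1 with hb
  set c : ℤ := (γ : SL(2, ℤ)) 1 0 with hcc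
  set d : ℤ := (γ : SL(2, ℤ)) 1 1 with hd
  set c' : ℤ := (γ' : SL(2, ℤ)) 1 0 with hcc'
  set d' : ℤ := (γ' : SL(2, ℤ)) 1 1 with hd'
  have hdetβ : x * Q - y * M = 1 := by
    have hdet := Matrix.det_fin_two (atkinLehnerSL N Q : SL(2, ℤ)).1
    rw [(atkinLehnerSL N Q : SL(2, ℤ)).2] at hdet
    have e10' : (atkinLehnerSL N Q : SL(2, ℤ)).1 1 0 = (M : ℤ) := h10
    have e11' : (atkinLehnerSL N Q : SL(2, ℤ)).1 1 1 = (Q : ℤ) := h11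
    rw [e10', e11'] at hdet
    linear_combination -hdet
  have hNQM : (N : ℤ) = (Q : ℤ) * M := by rw [hMdef]; exact_mod_cast (Nat.mul_div_cancel' hQN).symm
  obtain ⟨c₀, hc₀⟩ : (N : ℤ) ∣ c := (ZMod.intCast_zmod_eq_zero_iff_dvd _ N).mp (Gamma0_mem.mp γ.2)
  have hc₀' : c = (Q : ℤ) * M * c₀ := by rw [hc₀, hNQM]
  have e10 := congrFun (congrFun hint 1) 0
  have e11 := congrFun (congrFun hint 1) 1
  simp [MultOrbit.Wint, Matrix.mul_apply, Fin.sum_univ_two] at e10 e11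
  -- e10 : c' * (Q * x) + d' * (Q * M) = Q * M * a + Q * c ;  e11 : c' * y + d' * Q = Q * M * b + Q * d
  have hQ0 : (Q : ℤ) ≠ 0 := by exact_mod_cast NeZero.ne Q
  have E1 : c' * x + d' * M = M * a + c := by
    have : (Q : ℤ) * (c' * x + d' * M - (M * a + c)) = 0 := by linear_combination e10
    rcases mul_eq_zero.mp this with h0 | h0
    · exact absurd h0 hQ0
    · linear_combination h0
  have hd'eq : d' = x * Q * M * b + x * Q * d - y * M * a - y * c := by
    linear_combination (-y) * E1 + x * e11 - d' * hdetβ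
  refine ⟨⟨x * M * b + x * d - x * a - y * M * c₀, ?_⟩, ⟨x * Q * b - y * a + d * y - y * Q * c₀, ?_⟩⟩
  · linear_combination hd'eq + a * hdetβ - y * hc₀'
  · linear_combination hd'eq + d * hdetβ - y * hc₀'

/-- The `d`-entry of the chosen conjugate `alConj`: `≡ a_γ (mod Q)`, `≡ d_γ (mod N/Q)`. [cite: AtkinLehner1970, Lemma 8] -/
theorem alConj_apply_one_one [NeZero N] (Q : ℕ) [NeZero Q] (hQN : Q ∣ N) (hc : Nat.Coprime Q (N / Q)) (γ : Gamma0 N) :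
    (Q : ℤ) ∣ ((alConj Q hQN hc γ : SL(2, ℤ)) 1 1 : ℤ) - (γ : SL(2, ℤ)) 0 0 ∧
      ((N / Q : ℕ) : ℤ) ∣ ((alConj Q hQN hc γ : SL(2, ℤ)) 1 1 : ℤ) - (γ : SL(2, ℤ)) 1 1 :=
  apply_one_one_of_conj_atkinLehnerW Q hQN hc (alConj_spec Q hQN hc γ)

/-- An additive-on-units `χ₀` kills `1`. [folklore] -/
theorem char_one_eq_zero {L' : ℕ} {F : Type*} [CommRing F] (χ₀ : ZMod L' → F)
    (hχ₀ : ∀ a b : ZMod L', IsUnit a → IsUnit b → χ₀ (a * b) = χ₀ a + χ₀ b) : χ₀ 1 = 0 := by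
  have h := hχ₀ 1 1 isUnit_one isUnit_one
  rw [mul_one] at h
  linear_combination -h

/-- **`W_Q E_χ₀ = +E_χ₀` when `q₀ ∣ N/Q`** (`d_{γ'} ≡ d_γ (mod N/Q)`). [cite: AtkinLehner1970, Lemma 8] -/
theorem alOp_diamondFun_of_dvd_compl [NeZero N] (Q : ℕ) [NeZero Q] (hQN : Q ∣ N) (hc : Nat.Coprime Q (N / Q))
    {q₀ : ℕ} (hq : q₀ ∣ N / Q) {F : Type*} [CommRing F] (χ₀ : ZMod q₀ → F) :
    alOp F Q hQN hc (diamondFun N q₀ F χ₀) = diamondFun N q₀ F χ₀ := by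
  funext γ k
  simp only [alOp_apply, diamondFun_apply]
  obtain ⟨-, hM⟩ := alConj_apply_one_one Q hQN hc γ
  have hq' : (q₀ : ℤ) ∣ ((alConj Q hQN hc γ : SL(2, ℤ)) 1 1 : ℤ) - (γ : SL(2, ℤ)) 1 1 :=
    dvd_trans (Int.natCast_dvd_natCast.mpr hq) hM
  rw [(ZMod.intCast_eq_intCast_iff_dvd_sub _ _ q₀).mpr (by simpa [dvd_sub_comm] using hq')]

/-- **`W_Q E_χ₀ = −E_χ₀` when `q₀ ∣ Q`** (`d_{γ'} ≡ a_γ ≡ d_γ⁻¹ (mod q₀)` and `χ₀(d⁻¹) = −χ₀(d)`). [cite: AtkinLehner1970, Lemma 8] -/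
theorem alOp_diamondFun_of_dvd_self [NeZero N] (Q : ℕ) [NeZero Q] (hQN : Q ∣ N) (hc : Nat.Coprime Q (N / Q))
    {q₀ : ℕ} (hq : q₀ ∣ Q) {F : Type*} [CommRing F] (χ₀ : ZMod q₀ → F)
    (hχ₀ : ∀ a b : ZMod q₀, IsUnit a → IsUnit b → χ₀ (a * b) = χ₀ a + χ₀ b) :
    alOp F Q hQN hc (diamondFun N q₀ F χ₀) = (-1 : F) • diamondFun N q₀ F χ₀ := by
  have hq₀N : q₀ ∣ N := dvd_trans hq hQN
  funext γ k
  simp only [alOp_apply, diamondFun_apply, Pi.smul_apply, smul_eq_mul, neg_one_mul]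
  obtain ⟨hQ, -⟩ := alConj_apply_one_one Q hQN hc γ
  have hq' : (q₀ : ℤ) ∣ ((alConj Q hQN hc γ : SL(2, ℤ)) 1 1 : ℤ) - (γ : SL(2, ℤ)) 0 0 :=
    dvd_trans (Int.natCast_dvd_natCast.mpr hq) hQ
  rw [(ZMod.intCast_eq_intCast_iff_dvd_sub _ _ q₀).mpr (by simpa [dvd_sub_comm] using hq')]
  have had := gamma0_a_mul_d_cast hq₀N γ
  have hu_a : IsUnit ((((γ : SL(2, ℤ)) 0 0 : ℤ) : ZMod q₀)) := IsUnit.of_mul_eq_one _ had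
  have hu_d : IsUnit ((((γ : SL(2, ℤ)) 1 1 : ℤ) : ZMod q₀)) := gamma0_d_cast_isUnit hq₀N γ
  have h := hχ₀ _ _ hu_a hu_d
  rw [had, char_one_eq_zero χ₀ hχ₀] at h
  linear_combination -h

end DiamondSector

end Summit.BirchSwinnertonDyer.BirchSwinnertonDyer.Theorems.ManinLocalTwoThree.ShimuraSector

end
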